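import Mathlib.Data.Real.Basic
import Mathlib.Tactic.Linarith
import Mathlib.Tactic.Ring
import Mathlib.Tactic.Positivity
import HarnessLib

/-!
# Two-cuts with the root and one target on the root side (MODE B), I: the near-side real lemmas

Support file for the Sahi programme (`--supports stmt-CriticalPhenomena-4575`, prover prim-sahi-p2 gen 25).  No definitions, no named
facts, no sorries; standard axioms.  Memo `run/shared/lean/prim/prim-sahi/FROM-prim-sahi-p2-gen25-MODE-B-CONE.md` §3.

**Setting.**  A two-separator `{x, y}` NOT containing the root `s`; the NEAR side contains `s` and the lone target `a`, the far side the
targets `b, c`.  Classes of the root's port connectivity inside the near side: `X` (`s ~ x` only), `Y`, `XY` (both), `0′` (neither), with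
`x̄ = P(s ~ x)`, `ȳ = P(s ~ y)`, `w = P(both)`, `ū = x̄ + ȳ − w = P(s ~ x ∨ s ~ y)`; a (pseudo-)law of the event `A = {a ~ s}` over the classes is
a vector `(a₀, aX, aY, aXY)` with total mass `α`, and `pX = aX + aXY = P(A, s ~ x)`, `pY = aY + aXY`, `pU = aX + aY + aXY`.  The Harris rows are
`x̄·α ≤ pX`, `ȳ·α ≤ pY`, `ū·α ≤ pU`, `w·α ≤ aXY`, and the near star row is `S = 2aXY − pX·ȳ − pY·x̄ − (w − x̄ȳ)·α ≥ 0`.  The quantities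
`e(T,U) = E₃ᴺ(A, J(T), J(U))` for the port filters (`J(x) = {s~x}`, `J(y)`, `J(xy) = {s~x ∨ s~y}`) are
`e(x,x) = (1−x̄)(2pX − αx̄)`, `e(x,y) = S`, `e(x,xy) = pX(2−ū) − x̄·pU − αx̄(1−ū)`, `e(xy,xy) = (1−ū)(2pU − αū)` (and mirrors); the CHARGES of
the memo's §3 are `kX = α(x̄−w) − 2aX`, `kY = α(ȳ−w) − 2aY`.  This file proves that every `e` is `≥ 0` and `≥` its charge, from the Harris rows and
elementary constraints on `(x̄, ȳ, w)` only (Steps 2 and 4 of the memo's proof); the assembly (Steps 1, 3) is the sequel.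
-/

namespace Summit.CriticalPhenomena.PercolationContinuityZ3.Theorems

namespace IncStarTwoCut

/-- `e(x,x) = (1 − x̄)(2pX − αx̄) ≥ 0` from the Harris row `x̄α ≤ pX`, `0 ≤ pX` and `x̄ ≤ 1`. [this work] -/
theorem e_xx_nonneg {xb α pX : ℝ} (hxb1 : xb ≤ 1) (hpX : 0 ≤ pX) (hHx : xb * α ≤ pX) :
    0 ≤ (1 - xb) * (2 * pX - α * xb) :=
  mul_nonneg (sub_nonneg.2 hxb1) (by linarith)

/-- `e(x,xy) = pX(2−ū) − x̄·pU − αx̄(1−ū) ≥ (2−ū)(pX − αx̄) ≥ 0` from `x̄α ≤ pX` (Harris), `pU ≤ α`, `0 ≤ x̄`, `ū ≤ 2`. [this work] -/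
theorem e_xU_nonneg {xb ub α pX pU : ℝ} (hxb : 0 ≤ xb) (hub : ub ≤ 2) (hpUα : pU ≤ α) (hHx : xb * α ≤ pX) :
    0 ≤ pX * (2 - ub) - xb * pU - α * xb * (1 - ub) := by
  have hid : pX * (2 - ub) - xb * pU - α * xb * (1 - ub) = (2 - ub) * (pX - xb * α) + xb * (α - pU) := by ring
  rw [hid]
  exact add_nonneg (mul_nonneg (by linarith) (by linarith)) (mul_nonneg hxb (by linarith))

/-- `e(xy,xy) = (1 − ū)(2pU − αū) ≥ 0` from `ūα ≤ pU`, `0 ≤ pU`, `ū ≤ 1`. [this work] -/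
theorem e_UU_nonneg {ub α pU : ℝ} (hub1 : ub ≤ 1) (hpU : 0 ≤ pU) (hHu : ub * α ≤ pU) :
    0 ≤ (1 - ub) * (2 * pU - α * ub) :=
  mul_nonneg (sub_nonneg.2 hub1) (by linarith)

/-- **Charge (C1), two-sided.**  The near star row `S = 2aXY − pXȳ − pYx̄ − (w − x̄ȳ)α` dominates the SUM of the two charges:
`S ≥ (α(x̄−w) − 2aX) + (α(ȳ−w) − 2aY)`, from the Harris row `ūα ≤ aX + aY + aXY` and the elementary constraints `0 ≤ aX, aY, α`,
`w ≤ x̄ ≤ 1`, `w ≤ ȳ ≤ 1`, `x̄ + ȳ − 1 ≤ w`. [this work] -/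
theorem star_ge_charge_sum {xb yb w α aX aY aXY : ℝ}
    (haX : 0 ≤ aX) (haY : 0 ≤ aY) (hα : 0 ≤ α)
    (hwx : w ≤ xb) (hwy : w ≤ yb) (hxb1 : xb ≤ 1) (hyb1 : yb ≤ 1) (hw0 : 0 ≤ w) (hq0 : xb + yb - 1 ≤ w)
    (hHu : (xb + yb - w) * α ≤ aX + aY + aXY) :
    (α * (xb - w) - 2 * aX) + (α * (yb - w) - 2 * aY)
      ≤ 2 * aXY - (aX + aXY) * yb - (aY + aXY) * xb - (w - xb * yb) * α := by
  -- S − charges ≥ α·[x̄(1−x̄) + ȳ(1−ȳ) − x̄ȳ − w(1 − x̄ − ȳ)] + aX·x̄ + aY·ȳ, using aXY ≥ ūα − aX − aY with coefficient 2 − x̄ − ȳ ≥ 0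
  have h2 : 0 ≤ 2 - xb - yb := by linarith
  have hkey : (2 - xb - yb) * ((xb + yb - w) * α) ≤ (2 - xb - yb) * (aX + aY + aXY) :=
    mul_le_mul_of_nonneg_left hHu h2
  -- the bracket B = x̄(1−x̄) + ȳ(1−ȳ) − x̄ȳ − w(1−x̄−ȳ) is ≥ 0: if x̄ + ȳ ≤ 1 use w ≤ x̄ (giving ȳ(1−ȳ) + (x̄−w)(1−x̄−ȳ) ≥ 0);
  -- if x̄ + ȳ ≥ 1 use w ≥ x̄ + ȳ − 1 (giving (1−x̄)(1−ȳ) + (w − x̄ − ȳ + 1)(x̄ + ȳ − 1) ≥ 0).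
  have hB : 0 ≤ α * (xb * (1 - xb) + yb * (1 - yb) - xb * yb - w * (1 - xb - yb)) := by
    apply mul_nonneg hα
    rcases le_or_gt (xb + yb) 1 with hle | hgt
    · have : xb * (1 - xb) + yb * (1 - yb) - xb * yb - w * (1 - xb - yb)
          = yb * (1 - yb) + (xb - w) * (1 - xb - yb) := by ring
      rw [this]
      exact add_nonneg (mul_nonneg (by linarith) (by linarith)) (mul_nonneg (by linarith) (by linarith))
    · have : xb * (1 - xb) + yb * (1 - yb) - xb * yb - w * (1 - xb - yb)
          = (1 - xb) * (1 - yb) + (w - (xb + yb - 1)) * (xb + yb - 1) := by ring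
      rw [this]
      exact add_nonneg (mul_nonneg (by linarith) (by linarith)) (mul_nonneg (by linarith) (by linarith))
  have haXx : 0 ≤ aX * xb := mul_nonneg haX (by linarith)
  have haYy : 0 ≤ aY * yb := mul_nonneg haY (by linarith)
  nlinarith [hkey, hB, haXx, haYy]

/-- **Charge (C1), one-sided.**  `S ≥ α(x̄−w) − 2aX`, from the Harris row `x̄α ≤ aX + aXY`, `aY ≤ α − (aX + aXY)` (i.e. `a₀ ≥ 0`) and the
elementary constraints `0 ≤ x̄ ≤ 1`, `ȳ ≤ 1`, `x̄ȳ ≤ w`. [this work] -/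
theorem star_ge_charge_x {xb yb w α aX aY aXY : ℝ}
    (haX : 0 ≤ aX) (hα : 0 ≤ α)
    (hxb0 : 0 ≤ xb) (hxb1 : xb ≤ 1) (hyb1 : yb ≤ 1) (hc : xb * yb ≤ w)
    (hHx : xb * α ≤ aX + aXY) (ha0 : aX + aY + aXY ≤ α) :
    α * (xb - w) - 2 * aX ≤ 2 * aXY - (aX + aXY) * yb - (aY + aXY) * xb - (w - xb * yb) * α := by
  -- S ≥ α(2x̄ − x̄² − w) − aX(2−x̄) − aY·x̄ using aXY ≥ x̄α − aX with coefficient 2 − x̄ − ȳ ≥ 0; then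
  -- S − (α(x̄−w) − 2aX) ≥ x̄·(α(1−x̄) + aX − aY) ≥ x̄·(aX + aXY − x̄α) ≥ 0.
  have h2 : 0 ≤ 2 - xb - yb := by linarith
  have hkey : (2 - xb - yb) * (xb * α) ≤ (2 - xb - yb) * (aX + aXY) := mul_le_mul_of_nonneg_left hHx h2
  have hfin : 0 ≤ xb * (aX + aXY - xb * α) := mul_nonneg hxb0 (by linarith)
  have hcα : 0 ≤ (w - xb * yb) * α := mul_nonneg (by linarith) hα
  nlinarith [hkey, hfin, hcα, mul_nonneg hxb0 haX, mul_nonneg hxb0 hα, mul_nonneg (sub_nonneg.2 hyb1) hα]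

/-- **Charge (C2) for `e(y,y)`.**  `(1−ȳ)(2pY − αȳ) ≥ α(x̄−w) − 2aX`, from the Harris row `ūα ≤ aX + pY` (`pY = aY + aXY`,
`ū = x̄ + ȳ − w`), `0 ≤ aX`, `0 ≤ α` and `x̄ − w ≤ 1 − ȳ`, `w ≤ x̄`, `0 ≤ ȳ ≤ 1`. [this work] -/
theorem e_yy_ge_charge_x {xb yb w α aX pY : ℝ}
    (haX : 0 ≤ aX) (hα : 0 ≤ α) (hyb0 : 0 ≤ yb) (hyb1 : yb ≤ 1) (hwx : w ≤ xb) (hq : xb - w ≤ 1 - yb)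
    (hHu : (xb + yb - w) * α ≤ aX + pY) :
    α * (xb - w) - 2 * aX ≤ (1 - yb) * (2 * pY - α * yb) := by
  -- 2pY − αȳ ≥ α(2x̄ + ȳ − 2w) − 2aX; then LHS − charge ≥ α[(x̄−w)(1−2ȳ) + ȳ(1−ȳ)] + 2aXȳ and the bracket is ≥ 0 in both cases ȳ ≤ ½, ȳ ≥ ½.
  have h1 : 0 ≤ 1 - yb := sub_nonneg.2 hyb1
  have hkey : (1 - yb) * (2 * ((xb + yb - w) * α)) ≤ (1 - yb) * (2 * (aX + pY)) :=
    mul_le_mul_of_nonneg_left (by linarith) h1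
  have hB : 0 ≤ α * ((xb - w) * (1 - 2 * yb) + yb * (1 - yb)) := by
    apply mul_nonneg hα
    rcases le_or_gt yb (1/2) with hle | hgt
    · exact add_nonneg (mul_nonneg (by linarith) (by linarith)) (mul_nonneg hyb0 h1)
    · have : (xb - w) * (1 - 2 * yb) + yb * (1 - yb) = (1 - yb) * (1 - yb) + ((1 - yb) - (xb - w)) * (2 * yb - 1) := by ring
      rw [this]
      exact add_nonneg (mul_nonneg h1 h1) (mul_nonneg (by linarith) (by linarith))
  nlinarith [hkey, hB, mul_nonneg haX hyb0]

/-- **Charge (C2) for `e(xy,y) = e(y,xy)`.**  `pY(2−ū) − ȳ·pU − αȳ(1−ū) ≥ α(x̄−w) − 2aX`, from `ūα ≤ pU = aX + pY` (Harris), `pU ≤ α`,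
`0 ≤ aX`, `0 ≤ α`, `0 ≤ ȳ`, `ū ≤ 1`, `w ≤ x̄`. [this work] -/
theorem e_Uy_ge_charge_x {xb yb w α aX pY pU : ℝ}
    (haX : 0 ≤ aX) (hα : 0 ≤ α) (hyb0 : 0 ≤ yb) (hub1 : xb + yb - w ≤ 1) (hwx : w ≤ xb)
    (hpU : pU = aX + pY) (hpUα : pU ≤ α) (hHu : (xb + yb - w) * α ≤ pU) :
    α * (xb - w) - 2 * aX ≤ pY * (2 - (xb + yb - w)) - yb * pU - α * yb * (1 - (xb + yb - w)) := by
  -- e(xy,y) ≥ (2−ū)(α(x̄−w) − aX) ≥ α(x̄−w) − 2aX  (using pY ≥ ūα − aX, pU ≤ α).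
  subst hpU
  have h2 : 0 ≤ 2 - (xb + yb - w) := by linarith
  have hkey : (2 - (xb + yb - w)) * ((xb + yb - w) * α - aX) ≤ (2 - (xb + yb - w)) * pY :=
    mul_le_mul_of_nonneg_left (by linarith) h2
  nlinarith [hkey, mul_nonneg hyb0 (sub_nonneg.2 hpUα), mul_nonneg (sub_nonneg.2 hub1) (mul_nonneg hα (by linarith : (0:ℝ) ≤ xb - w)),
    mul_nonneg (by linarith : (0:ℝ) ≤ xb + yb - w + 0) haX, haX, mul_nonneg hα (by linarith : (0:ℝ) ≤ xb - w)]

end IncStarTwoCut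

end Summit.CriticalPhenomena.PercolationContinuityZ3.Theorems
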